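import Literature.NumberTheory.EllipticCurves.KuriharaNumberInvariants
import HarnessLib

/-!
# The «stabilised level-lowering congruence of depth `m`» (LL_m) of the plus modular symbols of an
# elliptic newform — DEFINITIONS (the Lean NAME of route W2's displayed hypothesis), the print basis,
# and the delta to print

Topic `NumberTheory/EllipticCurves`; namespace `Literature.NumberTheory.EllipticCurves`. DEFINITIONS ONLY,
with bookkeeping API (nothing asserted, no named fact). Written by the `bsd-litref` typer `jsw17-ty` for
`bsd-addord-plan` g17's WANTED «(LL_1) as a Literature fact» (pub/bsd-addord/STATUS.md l.850 / l.855,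
memo `evidence-19679-w2c2-g4-levellowering.md` of item `stmt-BirchSwinnertonDyer-19679`), relayed by
`bsd-litref-lead` 2026-08-26T18:07:33Z. Consumers (they carry (LL_m) as DISPLAYED binders `q u φ hper
hφH hC`, verbatim the body of `IsStabilisedLevelLoweringCongruence` below):
`Summit.BirchSwinnertonDyer.BirchSwinnertonDyer.Theorems.KimAtThreeDeepLowerTamagawaLevelLowering`
(`kuriharaDivisibleAt_of_stabilisedCongruence`, `tamagawa_le_kuriharaPartialInfty_of_stabilisedCongruence`,
`deepLowerAtThree_row_of_missingLowerBoundAt_of_stabilisedCongruence`, …; cell `bsd-addord`, seats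
w2-c2 / acc2 / acc3 / w2-c4 / acc6; items 19679 / 19599 / 19075).

WHAT (LL_m) SAYS. `E/ℚ` with globally minimal model `W`, `p` a prime, `f ∈ S₂(Γ₀(N))` (the newform of
`E`), `q` a natural number (in the application `q ∣ N_E·p`, a «Tamagawa-`p` prime»): there are
`u ∈ ℤ/p^m` and a `1`-periodic `φ : ℚ → ℤ/p^m`, HECKE at every prime `ℓ ∤ N_E·p` with eigenvalue
`a_ℓ(E)` — `a_ℓ·φ(x) = Σ_{j<ℓ} φ((x+j)/ℓ) + φ(ℓx)` — such that the tree's rational plus symbols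
`[x]⁺_f = ratPlusSymbol f x` (normalised by the lattice real period `Ω⁺_f`, `PAdicLFunction.lean`;
Mazur–Tate–Teitelbaum §I.8) satisfy `[x]⁺_f ≡ u·(φ(x) − φ(qx)) (mod p^m)` for every `x ∈ ℚ`
(`ratModP (p^m)`, the tree's reduction of a `p`-integral rational). This is the SHAPE of «`f ≡ g_α
(mod 𝔭^m)` read on integral modular symbols», `g` an eigenform of level prime to `q`, `g_α = g − g|V_q`
its `q`-stabilisation with `U_q`-eigenvalue `α ≡ a_q(f) = 1`, `φ` = the reduced integral plus symbol of
`g` (so `[x]⁺_{g_α} = [x]⁺_g − α⁻¹[qx]⁺_g`): `{∞, x}_{g(qz)} = q⁻¹ {∞, qx}_g`, `β = q/α`.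
`u` is NOT required to be a unit and `φ` is NOT required to come from a modular form — exactly as the
consumers take it (when every `[x]⁺_f` vanishes mod `p^m`, (LL_m) holds with `u = 0`, `φ = 0`:
`isStabilisedLevelLoweringCongruence_of_forall_eq_zero`). A coefficient-extended variant
`IsStabilisedLevelLoweringCongruenceIn π` (values read in any commutative ring `R` through
`π : ℤ/p^m →+* R`, e.g. `R = 𝔽_𝔭 ⊋ 𝔽_p`, the residue field of `g`'s coefficient ring — the honest
range of `φ` in print) is provided with the transfer lemma `IsStabilisedLevelLoweringCongruence.map`.

PRINT BASIS (what IS printed, with the loci read for this file) — and the DELTA. No source located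
prints (LL_1) verbatim (presearch below). The printed results it is assembled from:
* LEVEL LOWERING (form level). Ribet 1990 Thm. 1.1 (+ Carayol, Diamond 1995 Thm. 1.1): in the tree
  as the named fact `Literature.NumberTheory.Automorphic.diamond1995_refinedSerre`
  (`SerreWeakImpliesStrong.lean`; proved there from Khare–Wintenberger). At a Tamagawa-`p` prime `q`
  of `E` (`q ‖ N_E` split multiplicative with `p ∣ ord_q(Δ_E) = c_q`, so `ρ̄_{E,p}` is unramified at
  `q`; at `p = 3` also `q ≠ 3` additive of Kodaira type IV/IV* with `c_q = 3`) and `ρ̄_{E,p}`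
  irreducible, `p` odd, it yields a newform `g` of weight `2` and level `N_E/q` (resp. the Serre
  level) with `a_n(g) ≡ a_n(f) (mod 𝔭)` for `(n, N_E) = 1`. [cite: Ribet1990, Thm. 1.1]
  [cite: Diamond1995RefinedSerre, Thm. 1.1]
* MULTIPLICITY ONE / CANONICAL PERIODS (cohomology). Vatsal 1999 (Duke 98) Thms. 1.3, 2.7, 1.10 —
  paywalled, acquisition `acq-06215` = CITE-ONLY — as RESTATED in Greenberg–Vatsal 2000 §3
  (arXiv:math/9906215, held; PostScript chunks decoded): display (18) (chunk p0056) «if `α` is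
  admissible [any sign when `E[p]` is irreducible], it follows from work of Mazur, Ribet, Wiles, and
  others (see [Vat97], Theorems 1.3 and 2.7) that there is an isomorphism of `T₁(M)_𝔪`-modules
  `δ^α : S₂(Γ₁(M); ℤ_p)_𝔪 ≅ H¹_par(Γ₁(M); ℤ_p)^α_𝔪`» for ANY `M` with `N ∣ M` and `g` «any modular form
  of level `M` that is an eigenform for the full Hecke algebra `T₁(M)` … which satisfies `a_n = b_n`
  whenever `(n, M) = 1`»; canonical cocycles `δ^α_g` and canonical periods `Ω^α_g δ^α_g = ω^α_g` (19);
  Prop. (3.1) (p0057) «`E` optimal, `p` good ordinary or multiplicative: `Ω^α_E` and `(−2πi)Ω^α_f`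
  are equal up to a `p`-adic unit»; Rem. (3.4) (p0060) «if `E[p]` is irreducible … `Ω^α_E = Ω^α_f`
  for any choice of sign» (any isogenous curve); Lemma (3.6) (p0060) «`g` obtained from `f` by
  removing all Euler factors at primes `q ≠ p`, `q ∣ N`, `E` ordinary at `p`: `Ω^α_f` and `Ω^α_g` are
  equal up to `p`-adic unit»; Thm. (3.10) (p0064) «`E₁`, `E₂` of level `N₁`, `N₂`, `E₁[p] ≅ E₂[p]`
  irreducible, good ordinary or multiplicative at `p`, `Σ₀ = {q ≠ p : q ∣ N₁N₂}`: there exists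
  `u ∈ 𝒪^×` with `L^{Σ₀}(E₁/ℚ, χ, T) ≡ u·L^{Σ₀}(E₂/ℚ, χ, T) (mod π𝒪)` for every character `χ`», proof:
  «`a'_n ≡ b'_n (mod p)` for ALL integers `n`. Theorem 1.10 of [Vat97] now yields a congruence …
  the periods appearing will be the canonical periods attached to `g₁` and `g₂`. The result follows
  from Lemma (3.6)». [cite: GreenbergVatsal2000, §3 (18)–(19), Prop. (3.1), Rem. (3.4), Lemma (3.6), Thm. (3.10)]
  [cite: Vatsal1999, Thms. 1.3, 2.7, 1.10 (cite-only, acq-06215)]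
* The same multiplicity-one statement in the ordinary Hida tower: Emerton–Pollack–Weston 2006
  (arXiv:math/0404484, held) Prop. 4.1.1 (chunk p0020 L78–L82) «If `ρ̄_𝔪` is irreducible and
  `p`-distinguished, then each of the `(T_N)_𝔪`-modules `M^±_𝔪` is free of rank one», with the symbol
  map `ℙ¹(ℚ) → M_𝔪`, `a ↦ {∞, a}` (p0020 L117–L135), and Prop. 4.1.4 (p0021 L21–L32) «the
  specialisation at a classical height one prime is the usual analytic `p`-adic `L`-function …
  computed with respect to a canonical period». [cite: EmertonPollackWeston2006, Prop. 4.1.1 and Prop. 4.1.4]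
* CONTEXT. C.-H. Kim, *Refined applications of Kato's Euler systems for modular forms*
  (arXiv:2203.12157, held) p0009 L32–L33: «The assumption `N = N(ρ̄)` ensures that there is no Tamagawa
  defect [epw]. If the Tamagawa defect is non-trivial, then it is EXPECTED that all Kurihara numbers
  vanish [mazur-rubin-book]» — i.e. the consumers' conclusion `KuriharaDivisibleAt … 1` at a
  Tamagawa-`p` prime is called an expectation there, not a theorem; Kim–Ota (Res. Math. Sci. 2023,
  arXiv:1905.02926, held) Prop. 8.1 / Cor. 8.2 / Rem. 8.3 (p0026) print the Kolyvagin-SYSTEM analogue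
  («`q ‖ N`, `q ≢ ±1 (mod p)`, `ρ̄` unramified at `q` ⇒ Kato's Kolyvagin system of `f` is not
  primitive … at least we must consider a newform of level `N/q` obtained via level lowering»).
  [cite: Kim2022RefinedKatoApplications, §1 (chunk p0009 L32–L33)] [cite: KimOta2023, Prop. 8.1, Cor. 8.2, Rem. 8.3]

DELTA TO PRINT (for `bsd-addord-plan`; addord decides). (LL_1) — «at a Tamagawa-`p` prime `q`, with
`ρ̄_{E,p}` irreducible and `p` odd (`p ∤ N_E` or `p` ordinary), `IsStabilisedLevelLoweringCongruence
W p 1 f q` holds» — is NOT printed verbatim in any source located. The nearest printed theorem, GV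
Thm. (3.10), is (a) in the currency of `Σ₀`-imprimitive cyclotomic `p`-adic `L`-functions, which see
only character sums `Σ_a χ(a)[a/n]⁺` — and these do NOT determine the individual symbols `[a/n]⁺ mod p`
at Kolyvagin levels `n` (Fourier inversion over `(ℤ/n)^×` divides by `∏(ℓ − 1)`, divisible by `p`
since `ℓ ≡ 1 (mod p)`), so (3.10) does not imply (LL_1) formally; (b) stated for TWO ELLIPTIC CURVES,
while Ribet's `g` need not have rational coefficients; (c) for `p` good ORDINARY or multiplicative
(Vatsal's multiplicity one needs `𝔪` `p`-distinguished; supersingular `p` is outside [GV]/[EPW]).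
The symbol-wise congruence (LL_1) follows from display (18) at `M = N_E` applied to `f` and to the
full-level-`N_E` eigenform `g_α` (both in `S₂(Γ₁(N_E); 𝒪)_𝔪`, `a_n(f) ≡ a_n(g_α) (mod 𝔭)` for ALL
`n`, hence `δ^α(f) ≡ δ^α(g_α) (mod 𝔭)`), the passage from parabolic cocycles to `{∞, x}`-symbols at
an irreducible `𝔪` (Eisenstein part `𝔪`-trivial, [EPW] p0020 L33–L37), and the period comparisons
Prop. (3.1)/Rem. (3.4) (`Ω⁺_f` vs `Ω^+_{can}` — where `p`-adic units enter `u`, and where, if the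
lattice normalisation is off by a non-unit, ALL `[x]⁺_f` vanish mod `p` and (LL_1) holds trivially) —
an ARGUMENT, i.e. prover work for a `Theorems/` file over typed inputs, not a statement this
Literature file may assert (D-0026: no fact stronger than, or absent from, its source). Hence this
file gives (LL_m) its NAME and records the basis; it asserts nothing. `m ≥ 2`: level lowering mod
`p^m` (Dahmen–Yazdani 2012) is the only printed input; no symbol-level statement located.

PRESEARCH (2026-08-26, corpus fts+vec AND galaxy): «Vatsal canonical periods congruence formulae» →
[corpus] 8 citing papers, Vatsal 1999 itself not held → `lit read doi:10.1215/s0012-7094-99-09811-3`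
rc paywalled, acq-06215 CITE-ONLY; [corpus:paper:arxiv-math_9906215] GV2000 §3 (decoded, loci above);
[corpus:paper:arxiv-math_0404484] EPW06 §4.1 (loci above); `lit vsearch` «two congruent weight-two
newforms of different levels … plus modular symbols … congruent after removing Euler factors» → books
only (Delbourgo 2008 §4.3 «Multiplicity one for I-adic modular symbols», Hida-family currency);
`lit search --hybrid` «congruent modular symbols level lowering multiplicity one Euler factor canonical
periods» → same; [galaxy:pdf] «Canonical periods and congruence formulae|…» → Bellaïche–Pollack,
Pollack–Weston (Mazur–Tate elements of non-ordinary forms), Pollack–Stevens — none prints (LL_1);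
[corpus:paper:arxiv-2203.12157 p0009 L33] «expected»; [corpus:paper:arxiv-1905.02926 p0026] KS analogue;
[corpus:paper:arxiv-1509.00682] Ota 2018 Props. 2.3/3.3 = Mazur–Tate element relations (the
consumers' algebra), no level lowering. Tree: `lean search 'modularSymbol|MazurTate|stabilisedCongruence|
levelLowering'` → the symbol vocabulary used below and the Summits consumers; no Literature name for
(LL_m) before this file; Ribet = `diamond1995_refinedSerre`.

PARTITION: 0 classes (types-the-object-of; route W2 `KimAtThreeKolyvagin`, items 19679 / 19599 /
19075 — B3 N11@3). Nothing here proves BSD or moves a row.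
-/

noncomputable section

open scoped MatrixGroups ModularForm Classical BigOperators

open CongruenceSubgroup Literature.NumberTheory.EllipticCurves.ModularForms

open Literature.NumberTheory.DiophantineGeometry.Dioph (ratModP)

namespace Literature.NumberTheory.EllipticCurves

section Definitions

variable (W : WeierstrassCurve ℚ) [W.IsGloballyMinimal] (p m : ℕ) {N : ℕ} (f : CuspForm (Gamma0 N) 2)

/-- **(LL_m), the stabilised level-lowering congruence of depth `m` at `q`** for the plus symbols
of `f ∈ S₂(Γ₀(N))` relative to the curve `W` (which supplies the good primes `ℓ ∤ N_E·p` and the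
eigenvalues `a_ℓ(E)`): there are `u ∈ ℤ/p^m` and a `1`-periodic `φ : ℚ → ℤ/p^m`, Hecke at every prime
`ℓ ∤ N_E·p` with eigenvalue `a_ℓ(E)` (`a_ℓ·φ(x) = Σ_{j<ℓ} φ((x+j)/ℓ) + φ(ℓx)`), such that
`[x]⁺_f ≡ u·(φ(x) − φ(qx)) (mod p^m)` for all `x ∈ ℚ` (`ratModP (p^m) (ratPlusSymbol f x)`). VERBATIM
the displayed binders `u φ hper hφH hC` of the `bsd-addord` consumers (module docstring); `u` need
not be a unit, `φ` need not be modular. In print only the SHAPE is attested (the `q`-stabilisation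
`g_α = g − g|V_q` of a level-lowered eigenform `g`, [GreenbergVatsal2000] §3 / [Ribet1990]); the
existence statement (LL_1) at a Tamagawa-`p` prime is NOT printed verbatim — see «DELTA TO PRINT».
A predicate; nothing asserted. [cite: GreenbergVatsal2000, §3 display (18)–(19) and Lemma (3.6) (shape of the q-deprived eigenform)]
[cite: Kim2022StructureSelmer, §1.5.1 and Def. 2.13 (the Kurihara-number side it feeds)] -/
def IsStabilisedLevelLoweringCongruence (q : ℕ) : Prop :=
  ∃ (u : ZMod (p ^ m)) (φ : ℚ → ZMod (p ^ m)),
    (∀ x, φ (x + 1) = φ x) ∧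
    (∀ ℓ : ℕ, ℓ.Prime → ¬ ℓ ∣ W.conductorNorm ℤ * p → ∀ x : ℚ,
      (W.frobeniusTrace ℓ : ZMod (p ^ m)) * φ x = (∑ j : Fin ℓ, φ ((x + j) / ℓ)) + φ (ℓ * x)) ∧
    (∀ x : ℚ, ratModP (p ^ m) (ratPlusSymbol f x) = u * (φ x - φ (q * x)))

/-- **(LL_m) with coefficients extended along `π : ℤ/p^m →+* R`** — the same shape with `u ∈ R`,
`φ : ℚ → R`, the Hecke relation in `R` and the symbols read through `π ∘ ratModP (p^m)`. For `m = 1`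
and `R = 𝔽` a finite field of characteristic `p` this is the honest range of print's `φ` (the reduced
canonical plus symbol of the level-lowered eigenform `g` has values in the residue field `𝔽_𝔭` of
`g`'s coefficient ring, possibly `⊋ 𝔽_p`; the consumers' «part 4» field-valued bridge).
A predicate; nothing asserted. [cite: GreenbergVatsal2000, §3 display (18)–(19) (eigenforms with coefficients in 𝒪, congruences mod 𝔭)] -/
def IsStabilisedLevelLoweringCongruenceIn (q : ℕ) {R : Type*} [CommRing R] (π : ZMod (p ^ m) →+* R) :
    Prop :=
  ∃ (u : R) (φ : ℚ → R),
    (∀ x, φ (x + 1) = φ x) ∧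
    (∀ ℓ : ℕ, ℓ.Prime → ¬ ℓ ∣ W.conductorNorm ℤ * p → ∀ x : ℚ,
      (W.frobeniusTrace ℓ : R) * φ x = (∑ j : Fin ℓ, φ ((x + j) / ℓ)) + φ (ℓ * x)) ∧
    (∀ x : ℚ, π (ratModP (p ^ m) (ratPlusSymbol f x)) = u * (φ x - φ (q * x)))

end Definitions

section API

variable {W : WeierstrassCurve ℚ} [W.IsGloballyMinimal] {p m : ℕ} {N : ℕ} {f : CuspForm (Gamma0 N) 2}
  {q : ℕ} {R : Type*} [CommRing R]

/-- Unfolding `IsStabilisedLevelLoweringCongruence` (binder-for-binder the consumers' `u φ hper hφH hC`);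
bookkeeping for the shape of [cite: GreenbergVatsal2000, §3 display (18)–(19)]. -/
theorem isStabilisedLevelLoweringCongruence_iff :
    IsStabilisedLevelLoweringCongruence W p m f q ↔
      ∃ (u : ZMod (p ^ m)) (φ : ℚ → ZMod (p ^ m)),
        (∀ x, φ (x + 1) = φ x) ∧
        (∀ ℓ : ℕ, ℓ.Prime → ¬ ℓ ∣ W.conductorNorm ℤ * p → ∀ x : ℚ,
          (W.frobeniusTrace ℓ : ZMod (p ^ m)) * φ x = (∑ j : Fin ℓ, φ ((x + j) / ℓ)) + φ (ℓ * x)) ∧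
        (∀ x : ℚ, ratModP (p ^ m) (ratPlusSymbol f x) = u * (φ x - φ (q * x))) :=
  Iff.rfl

/-- **The degenerate case.** If every plus symbol of `f` vanishes mod `p^m`, (LL_m) holds at every
`q`, with `u = 0` and `φ = 0` (the consumers note that their conclusion is then trivial anyway);
bookkeeping for the shape of [cite: GreenbergVatsal2000, §3 display (18)–(19)]
[cite: Kim2022StructureSelmer, Def. 2.13 (the vanishing it feeds)]. -/
theorem isStabilisedLevelLoweringCongruence_of_forall_eq_zero
    (h : ∀ x : ℚ, ratModP (p ^ m) (ratPlusSymbol f x) = 0) :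
    IsStabilisedLevelLoweringCongruence W p m f q :=
  ⟨0, fun _ => 0, fun _ => rfl, fun _ _ _ _ => by simp, fun x => by simp [h x]⟩

/-- **Extension of coefficients.** (LL_m) over `ℤ/p^m` gives (LL_m) read in any commutative ring `R`
through `π : ℤ/p^m →+* R` (`u ↦ π u`, `φ ↦ π ∘ φ`); bookkeeping for the shape of
[cite: GreenbergVatsal2000, §3 display (18)–(19) (coefficients 𝒪 → 𝒪/𝔭)]. -/
theorem IsStabilisedLevelLoweringCongruence.map (h : IsStabilisedLevelLoweringCongruence W p m f q)
    (π : ZMod (p ^ m) →+* R) : IsStabilisedLevelLoweringCongruenceIn W p m f q π := by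
  obtain ⟨u, φ, hper, hH, hC⟩ := h
  refine ⟨π u, fun x => π (φ x), fun x => by simp only [hper], fun ℓ hℓ hℓN x => ?_, fun x => ?_⟩
  · have := congrArg π (hH ℓ hℓ hℓN x)
    simpa [map_mul, map_add, map_sum, map_intCast] using this
  · rw [hC x, map_mul, map_sub]

/-- Over `R = ℤ/p^m` itself (`π = id`) the two predicates agree; bookkeeping for the shape of
[cite: GreenbergVatsal2000, §3 display (18)–(19)]. -/
theorem isStabilisedLevelLoweringCongruenceIn_id_iff :
    IsStabilisedLevelLoweringCongruenceIn W p m f q (RingHom.id (ZMod (p ^ m))) ↔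
      IsStabilisedLevelLoweringCongruence W p m f q := by
  simp only [IsStabilisedLevelLoweringCongruenceIn, IsStabilisedLevelLoweringCongruence, RingHom.id_apply]

end API

end Literature.NumberTheory.EllipticCurves

end
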